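import Summits.QuantumFields.BalabanUV.Beta.GAN24.BornBorderLift
import Summits.QuantumFields.BalabanUV.Beta.GAN24.BornBorderTent
import Summits.QuantumFields.BalabanUV.Beta.GAN24.Push3Nest
import Summits.QuantumFields.BalabanUV.Beta.GAN24.RespStepBmDecompPsi
import Summits.QuantumFields.BalabanUV.Beta.GAN24.ScaleNesting
import Summits.QuantumFields.BalabanUV.Beta.GAN24.ContactBorderCommutator

/-!
# GAN24 ∕ BORNSEC, V half — `BornBorderLiftChain`: THE MULTI-LEVEL UNDRESSED V LINEAGE OF THE COMB FAMILY IS ROAD S3's ROOTED PUSHED BORDER ROW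

NOT IN PRINT; OUR BOOKKEEPING ([folklore] finite lattice algebra over tree names; no estimate of Bałaban's is formalised, cited or discharged here).
HONEST: discharges NOTHING of `hB` ∕ `(hS, hSall)`; NEVER «G-an2-4 closed»; NOT (CONV-C), NOT D1, NOT `BetaPertH`, NOT continuum, NOT Clay.

WHAT ((V-U) PART 2b of the owner's BORNV-PLAN-v0; PART 1 = `BornBorderLift`, PART 2a = `BornBorderTent`).  The (V-1) socket (leaf-01's `BornBorderLetters.exists_hUv_of_geometric`)
asks for `LocStencil` bounds on the UNDRESSED lineages `w^{k−i} • push₃ B′ B′ B′ Y⁰_i`, `B′ = respStep (Lc^(i+1)) (Lc^k)`,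
`Y⁰_i = −(push₃ (−R⁰_i) (colM K̃_i Lc) R⁰_i (reslot inl inr V) + push₃ (rowMM K̃_i Lc) R⁰_i R⁰_i (reslot inr inl V))`, `R⁰_i = respStep (Lc^i) (Lc^(i+1))`, `K̃_i = KStepUnit Lc i`,
`V = cVH • vhSAt ρ`.  §2 composes the legs (leaf-05's `Push3Nest.push₃_push₃`, leaf-12's `legComp_respStep`, PART 2a's tent): for `N = Lc^(i+1)·R`,
`push₃ B′³ Y⁰_i = (cVH·(smStep d Lc i)²) • (push₃ B (tentLeg Lc R N) B (reslot inl inr V₀) − push₃ (tentLeg Lc R N) B B (reslot inr inl V₀))`, `B = respStep (Lc^i) N`, `V₀ = vhSAt ρ`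
(`lineage_v_eq_tent_pair`).  §3 reads road S3's rooted pushed border row the same way: `e3OfS N (pushSum (Lc^(i+1)) R (borderSum (Lc^i) V₀))` = (`ScaleNesting.pushSum_avgLift`)
`e3OfS N (borderSum (Lc^i) (pushSum Lc R ∘ V₀))` = (PART 1 `mixed_push₃_eq_e3OfS_borderSum`) the plain mixed pair on the pushed table = (PART 2a `push₃_colM_pushSum` ∕ `push₃_rowMM_pushSum`)
`((Lc^i)^{d+2})⁻¹ •` the SAME tent pair (`road_v_eq_tent_pair`).  §4: **`lineage_v_eq_e3OfS_pushSum`** — the undressed V lineage IS `e3OfS N` of road S3's symmetric-table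
rooted row object with the k∕i-bookkept scalar `cVH·(smStep d Lc i)²·(Lc^i)^{d+2}` (pin `d = 3`: residual `Lc^4` against p2's `TaylorRowVSymAt.rowV_three_at` weights, as for Λ and Wilson).

Unit `b2b-balaban-gan24-p1` (row owner G-an2-4, gen 21), 2026-08-21.
-/

noncomputable section

open Finset
open scoped BigOperators
open Literature.MathematicalPhysics.QuantumFieldTheory
open Literature.MathematicalPhysics.QuantumFieldTheory.Balaban1983to89
open Literature.MathematicalPhysics.QuantumFieldTheory.Balaban1983to89.Beta
open ExpKernelCalculus (MKer Decays BiLoc)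
open OneStepResolventKernel (Fib LocStencil KInv decays_KInv)
open OneStepKernelFamily (dec colH decays_dec)
open BalabanStepJets (locStencil_mono)
open AffineAveraging (box toSite)
open AveragingHessianKernelsRooted (vhSAt locStencil_vhSAt)
open Summit.QuantumFields.BalabanUV.Beta.GAN24.StencilSlotVHRoot (vhSAt_inl_inl vhSAt_inr_inr)
open Summit.QuantumFields.BalabanUV.Beta.GAN24.CombesThomas (smStep KStepUnit)
open BalabanCompositeJets (respStep pushSum pushSum_inl_inl biLoc_pushSum)
open DecLiftAdjoint (borderSum avgLift_smul)
open InterLevelTransport (avgLift)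
open Summit.QuantumFields.BalabanUV.Beta.GAN24.Push4 (legComp IsFF)
open Summit.QuantumFields.BalabanUV.Beta.GAN24.Push4Bounds (LegDecay legDecay_colH)
open Summit.QuantumFields.BalabanUV.Beta.GAN24.Push3 (push₃ push₃_smul push₃_neg push₃_add locStencil_push₃_mono)
open Summit.QuantumFields.BalabanUV.Beta.GAN24.Push3Nest (push₃_push₃)
open Summit.QuantumFields.BalabanUV.Beta.GAN24.Push3LegTelescope (push₃_smul_left push₃_smul_right push₃_neg_left)
open Summit.QuantumFields.BalabanUV.Beta.GAN24.E3UnitSplit (e3OfS)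
open Summit.QuantumFields.BalabanUV.Beta.GAN24.SrecLinearPartEq (colM rowMM reslot legDecay_colM legDecay_rowMM locStencil_reslot)
open Summit.QuantumFields.BalabanUV.Beta.GAN24.RespStepSemigroup (legComp_respStep legComp_neg_left)
open Summit.QuantumFields.BalabanUV.Beta.GAN24.RespStepBmDecompPsi (legComp_smul_left legDecay_respStep_of_decays decays_KStepUnit_levels)
open Summit.QuantumFields.BalabanUV.Beta.GAN24.ScaleNesting (pushSum_avgLift)
open Summit.QuantumFields.BalabanUV.Beta.GAN24.PushSumNest (pushSum_finset_sum pushSum_smul)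
open Summit.QuantumFields.BalabanUV.Beta.GAN24.BornLambdaLift (colH_dec_KInv)
open Summit.QuantumFields.BalabanUV.Beta.GAN24.BornLambdaUndressedRow (e3OfS_smul)
open Summit.QuantumFields.BalabanUV.Beta.GAN24.BornBorderLift (mixed_push₃_eq_e3OfS_borderSum colM_KStepUnit rowMM_KStepUnit)
open Summit.QuantumFields.BalabanUV.Beta.GAN24.ContactBorderCommutator (reslot_smul)
open Summit.QuantumFields.BalabanUV.Beta.GAN24.BornBorderTent (tentLeg legComp_colM_dec_respStep legComp_rowMM_dec_respStep push₃_colM_pushSum push₃_rowMM_pushSum)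

namespace Summit.QuantumFields.BalabanUV.Beta.GAN24.BornBorderLiftChain

variable {d : ℕ}

/-! ## §1 Leg plumbing: localisation of the legs that occur -/

section Legs

variable {r : Fin (d + 1) → (Fin (d + 1) → ℤ) → Fin (d + 1) → (Fin (d + 1) → ℤ) → ℝ} {N : ℕ} {C m : ℝ}

/-- [folklore] The negated leg family is localised with the same data. -/
theorem legDecay_neg (h : LegDecay r N C m) : LegDecay (-r) N C m := fun μ y κ u => by
  simp only [Pi.neg_apply, abs_neg]; exact h μ y κ u

/-- [folklore] A scalar multiple of a localised leg family is localised (constant `|c|·C`). -/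
theorem legDecay_smul (c : ℝ) (h : LegDecay r N C m) : LegDecay (c • r) N (|c| * C) m := fun μ y κ u => by
  simp only [Pi.smul_apply, smul_eq_mul, abs_mul, mul_assoc]
  exact mul_le_mul_of_nonneg_left (h μ y κ u) (abs_nonneg c)

/-- [folklore] A localised leg family stays localised at any smaller positive rate. -/
theorem legDecay_mono (h : LegDecay r N C m) {m' : ℝ} (hm' : m' ≤ m) : LegDecay r N C m' := fun μ y κ u => by
  refine (h μ y κ u).trans (mul_le_mul_of_nonneg_left (Real.exp_le_exp.2 ?_) (h.nonneg))
  nlinarith [B12Sec2to5.l1_nonneg (u - (N : ℤ) • y)]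

/-- [folklore] **THE MULTI-LEVEL RESPONSE FAMILY IS A LOCALISED LEG FAMILY AT THE RELATIVE BLOCKING**: `respStep M′ N = (M′^{d+2}) • colH (dec M′ (KInv N)) R`
(`BornLambdaLift.colH_dec_KInv`), and `ℋ`-column legs of a decaying kernel are localised (leaf-17's `legDecay_colH`, an4's `decays_dec`, an5's `decays_KInv`). -/
theorem exists_legDecay_respStep {M' R N : ℕ} [NeZero M'] [NeZero R] [NeZero N] (hN : N = M' * R) :
    ∃ C m : ℝ, 0 < m ∧ LegDecay (respStep (d := d) M' N) R C m := by
  obtain ⟨δK, CK, hδK, hCK, hK⟩ := decays_KInv (N := N) (d := d)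
  have hM1 : 1 ≤ M' := Nat.one_le_iff_ne_zero.2 (NeZero.ne M')
  have hM : ((M' : ℝ) ^ (d + 2)) ≠ 0 := pow_ne_zero _ (by exact_mod_cast NeZero.ne M')
  have hD := legDecay_colH (N := R) (decays_dec hK hCK hδK.le hM1)
  have e : respStep (d := d) M' N = ((M' : ℝ) ^ (d + 2)) • colH (dec M' (KInv (N := N) (d := d))) R := by
    rw [colH_dec_KInv hN, smul_smul, mul_inv_cancel₀ hM, one_smul]
  rw [e]
  exact ⟨_, δK, hδK, legDecay_smul _ hD⟩

end Legs

/-! ## §2 The comb side: the undressed V lineage as ONE tent pair -/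

section Comb

variable {Lc : ℕ} [NeZero Lc]

variable {R N : ℕ} [NeZero R] [NeZero N]

/-- NOT IN PRINT; OUR BOOKKEEPING ([folklore]).  **THE (field, multiplier) LINEAGE CHANNEL AS ONE PUSH**: for a local family `P` and `N = Lc^(i+1)·R`,
`push₃ B′ B′ B′ (push₃ (−R⁰_i) (colM K̃_i Lc) R⁰_i P) = push₃ (−B) ((smStep d Lc i)² • tentLeg Lc R N) B P`, `B′ = respStep (Lc^(i+1)) N`, `B = respStep (Lc^i) N`
(leaf-05's `push₃_push₃`; `legComp_respStep`; PART 2a's `legComp_colM_dec_respStep` through `BornBorderLift.colM_KStepUnit`). -/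
theorem lineage_fm_eq_push₃ {P : Fin (d + 1) → (Fin (d + 1) → ℤ) → MKer (d + 1) (Fib d)} {Cs δ : ℝ} (hP : LocStencil P Cs δ) (hδ : 0 < δ)
    (i : ℕ) (hN : N = Lc ^ (i + 1) * R) (κ' : Fin (d + 1)) (u' : Fin (d + 1) → ℤ) :
    push₃ (respStep (d := d) (Lc ^ (i + 1)) N) (respStep (d := d) (Lc ^ (i + 1)) N) (respStep (d := d) (Lc ^ (i + 1)) N)
        (fun κ u => push₃ (-respStep (d := d) (Lc ^ i) (Lc ^ (i + 1))) (colM (KStepUnit (d := d) Lc i) Lc)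
          (respStep (d := d) (Lc ^ i) (Lc ^ (i + 1))) P κ u) κ' u'
      = push₃ (-respStep (d := d) (Lc ^ i) N) ((smStep d Lc i) ^ 2 • tentLeg Lc R N) (respStep (d := d) (Lc ^ i) N) P κ' u' := by
  obtain ⟨CK, mK, hmK, hK⟩ := decays_KStepUnit_levels (d := d) (Lc := Lc) i
  obtain ⟨C', m', hm', hB'⟩ := exists_legDecay_respStep (d := d) hN
  have hR0 := legDecay_respStep_of_decays hK
  rw [push₃_push₃ hB' hB' hB' (legDecay_neg hR0) (legDecay_colM (N := Lc) hK) hR0 hm' hmK hP hδ κ' u',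
    legComp_neg_left, legComp_respStep hN, colM_KStepUnit, legComp_smul_left]
  have ht : legComp (colM (dec (Lc ^ i) (KInv (N := Lc ^ (i + 1)) (d := d))) Lc) (respStep (d := d) (Lc ^ (i + 1)) N) = tentLeg Lc R N :=
    funext fun β => funext fun z' => funext fun ν => funext fun v => legComp_colM_dec_respStep (pow_succ Lc i) hN β z' ν v
  rw [ht]

/-- NOT IN PRINT; OUR BOOKKEEPING ([folklore]).  **THE (multiplier, field) LINEAGE CHANNEL AS ONE PUSH**:
`push₃ B′ B′ B′ (push₃ (rowMM K̃_i Lc) R⁰_i R⁰_i P) = push₃ ((smStep d Lc i)² • tentLeg Lc R N) B B P` (PART 2a's `legComp_rowMM_dec_respStep`). -/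
theorem lineage_mf_eq_push₃ {P : Fin (d + 1) → (Fin (d + 1) → ℤ) → MKer (d + 1) (Fib d)} {Cs δ : ℝ} (hP : LocStencil P Cs δ) (hδ : 0 < δ)
    (i : ℕ) (hN : N = Lc ^ (i + 1) * R) (κ' : Fin (d + 1)) (u' : Fin (d + 1) → ℤ) :
    push₃ (respStep (d := d) (Lc ^ (i + 1)) N) (respStep (d := d) (Lc ^ (i + 1)) N) (respStep (d := d) (Lc ^ (i + 1)) N)
        (fun κ u => push₃ (rowMM (KStepUnit (d := d) Lc i) Lc) (respStep (d := d) (Lc ^ i) (Lc ^ (i + 1)))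
          (respStep (d := d) (Lc ^ i) (Lc ^ (i + 1))) P κ u) κ' u'
      = push₃ ((smStep d Lc i) ^ 2 • tentLeg Lc R N) (respStep (d := d) (Lc ^ i) N) (respStep (d := d) (Lc ^ i) N) P κ' u' := by
  obtain ⟨CK, mK, hmK, hK⟩ := decays_KStepUnit_levels (d := d) (Lc := Lc) i
  obtain ⟨C', m', hm', hB'⟩ := exists_legDecay_respStep (d := d) hN
  have hR0 := legDecay_respStep_of_decays hK
  rw [push₃_push₃ hB' hB' hB' (legDecay_rowMM (N := Lc) hK) hR0 hR0 hm' hmK hP hδ κ' u',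
    legComp_respStep hN, rowMM_KStepUnit, legComp_smul_left]
  have ht : legComp (rowMM (dec (Lc ^ i) (KInv (N := Lc ^ (i + 1)) (d := d))) Lc) (respStep (d := d) (Lc ^ (i + 1)) N) = tentLeg Lc R N :=
    funext fun α => funext fun x' => funext fun μ => funext fun x => legComp_rowMM_dec_respStep (pow_succ Lc i) hN α x' μ x
  rw [ht]

/-- NOT IN PRINT; OUR BOOKKEEPING ([folklore]).  **THE UNDRESSED V LINEAGE AS ONE TENT PAIR** (in-block root `ρ = toSite rr`): for `N = Lc^(i+1)·R`,
`push₃ B′ B′ B′ Y⁰_i = (cVH·(smStep d Lc i)²) • (push₃ B (tentLeg Lc R N) B (reslot inl inr (vhSAt ρ)) − push₃ (tentLeg Lc R N) B B (reslot inr inl (vhSAt ρ)))`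
(§2's two channels + `Push3.push₃_neg ∕ push₃_add` on the local inner pushes + trilinearity; leaf-02's `ContactBorderCommutator.reslot_smul`). -/
theorem lineage_v_eq_tent_pair (hLc : 1 ≤ Lc) {rr : Fin (d + 1) → ℕ} (hrr : rr ∈ box (d + 1) Lc) (cVH : ℝ) (i : ℕ) (hN : N = Lc ^ (i + 1) * R)
    (κ' : Fin (d + 1)) (u' : Fin (d + 1) → ℤ) :
    push₃ (respStep (d := d) (Lc ^ (i + 1)) N) (respStep (d := d) (Lc ^ (i + 1)) N) (respStep (d := d) (Lc ^ (i + 1)) N)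
        (fun κ u => -(push₃ (-respStep (d := d) (Lc ^ i) (Lc ^ (i + 1))) (colM (KStepUnit (d := d) Lc i) Lc)
              (respStep (d := d) (Lc ^ i) (Lc ^ (i + 1))) (reslot Sum.inl Sum.inr fun κ u => cVH • vhSAt (toSite rr) d Lc rfl κ u) κ u
          + push₃ (rowMM (KStepUnit (d := d) Lc i) Lc) (respStep (d := d) (Lc ^ i) (Lc ^ (i + 1)))
              (respStep (d := d) (Lc ^ i) (Lc ^ (i + 1))) (reslot Sum.inr Sum.inl fun κ u => cVH • vhSAt (toSite rr) d Lc rfl κ u) κ u)) κ' u'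
      = (cVH * (smStep d Lc i) ^ 2) •
          (push₃ (respStep (d := d) (Lc ^ i) N) (tentLeg Lc R N) (respStep (d := d) (Lc ^ i) N)
              (reslot Sum.inl Sum.inr fun κ u => vhSAt (toSite rr) d Lc rfl κ u) κ' u'
            - push₃ (tentLeg Lc R N) (respStep (d := d) (Lc ^ i) N) (respStep (d := d) (Lc ^ i) N)
              (reslot Sum.inr Sum.inl fun κ u => vhSAt (toSite rr) d Lc rfl κ u) κ' u') := by
  -- the border table and its two mixed reslots are local at rate 1
  have hV : LocStencil (fun κ u => cVH • vhSAt (toSite rr) d Lc rfl κ u)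
      (|cVH| * (3 * (AveragingHessianKernels.ell (d + 1) Lc : ℝ) ^ 2 * Real.exp (4 * ((d : ℝ) + 1) * Lc * 1))) 1 :=
    StepJetData.locStencil_smul cVH (locStencil_vhSAt hLc hrr zero_le_one)
  have hPfm := locStencil_reslot hV Sum.inl Sum.inr
  have hPmf := locStencil_reslot hV Sum.inr Sum.inl
  -- the inner pushes are local (common legs data at blocking `Lc`), so the outer push is additive on them
  obtain ⟨CK, mK, hmK, hK⟩ := decays_KStepUnit_levels (d := d) (Lc := Lc) i
  obtain ⟨C', m', hm', hB'⟩ := exists_legDecay_respStep (d := d) hN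
  have hR0 := legDecay_respStep_of_decays hK
  have hCs := (hV 0 0).nonneg (Sum.inl 0)
  obtain ⟨δ₁, hδ₁, hδ₁1, h2δ₁⟩ : ∃ δ₁ : ℝ, 0 < δ₁ ∧ δ₁ ≤ 1 ∧ 2 * δ₁ < mK :=
    ⟨min 1 (mK / 4), lt_min one_pos (by linarith), min_le_left _ _, by linarith [min_le_right (1 : ℝ) (mK / 4)]⟩
  have hA := locStencil_push₃_mono hLc (legDecay_neg hR0) (legDecay_colM (N := Lc) hK) hR0
    (locStencil_mono hPfm hCs hδ₁1) hδ₁.le h2δ₁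
  have hBm := locStencil_push₃_mono hLc (legDecay_rowMM (N := Lc) hK) hR0 hR0 (locStencil_mono hPmf hCs hδ₁1) hδ₁.le h2δ₁
  rw [push₃_neg, push₃_add hB' hB' hB' hm' hA hBm hδ₁ hδ₁ κ' u',
    lineage_fm_eq_push₃ hPfm one_pos i hN κ' u', lineage_mf_eq_push₃ hPmf one_pos i hN κ' u',
    reslot_smul, reslot_smul, push₃_smul, push₃_smul, push₃_neg_left, push₃_smul_right, push₃_smul_left]
  funext x z a b
  simp only [Pi.smul_apply, Pi.neg_apply, Pi.add_apply, Pi.sub_apply, smul_eq_mul]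
  ring

end Comb

/-! ## §3 Road S3's side: the rooted pushed border row as the same tent pair -/

section Road

variable {Lc : ℕ} [NeZero Lc] {R N : ℕ} [NeZero R] [NeZero N]

/-- [folklore] `borderSum` is linear in the family. -/
theorem borderSum_smul (M : ℕ) (c : ℝ) (G : Fin (d + 1) → (Fin (d + 1) → ℤ) → MKer (d + 1) (Fib d)) (κ : Fin (d + 1)) (u : Fin (d + 1) → ℤ) :
    borderSum M (fun κ z => c • G κ z) κ u = c • borderSum M G κ u := by
  funext x w a b
  simp only [borderSum, avgLift_smul, Pi.smul_apply, Finset.smul_sum]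

omit [NeZero R] in
/-- [folklore] **`pushSum` FROM THE NEXT LEVEL COMMUTES WITH `borderSum`**: `pushSum (Lc^(i+1)) R (borderSum (Lc^i) G κ u) = borderSum (Lc^i) (pushSum Lc R ∘ G) κ u`
(`ScaleNesting.pushSum_avgLift` summand by summand, `PushSumNest.pushSum_finset_sum`). -/
theorem pushSum_borderSum (G : Fin (d + 1) → (Fin (d + 1) → ℤ) → MKer (d + 1) (Fib d)) (i : ℕ) (κ : Fin (d + 1)) (u : Fin (d + 1) → ℤ) :
    pushSum (Lc ^ (i + 1)) R (borderSum (Lc ^ i) G κ u) = borderSum (Lc ^ i) (fun κ z => pushSum Lc R (G κ z)) κ u := by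
  have e : borderSum (Lc ^ i) G κ u
      = ∑ s ∈ Finset.range (Lc ^ i), avgLift (Lc ^ i) (G κ (LatticeForm.quo (Lc ^ i) (u - BalabanCompositeJets.bshift d κ s))) := by
    funext x w a b; simp only [borderSum, Finset.sum_apply]
  have e' : borderSum (Lc ^ i) (fun κ z => pushSum Lc R (G κ z)) κ u
      = ∑ s ∈ Finset.range (Lc ^ i), avgLift (Lc ^ i) (pushSum Lc R (G κ (LatticeForm.quo (Lc ^ i) (u - BalabanCompositeJets.bshift d κ s)))) := by
    funext x w a b; simp only [borderSum, Finset.sum_apply]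
  rw [e, e', pushSum_finset_sum]
  refine Finset.sum_congr rfl fun s _ => ?_
  rw [← pushSum_avgLift (Lc ^ i) Lc R, ← pow_succ]

/-- [folklore] The pushed border table is local: `pushSum` keeps bi-localisation (an2's `biLoc_pushSum`). -/
theorem locStencil_pushSum {V : Fin (d + 1) → (Fin (d + 1) → ℤ) → MKer (d + 1) (Fib d)} {Cs δ : ℝ} (hV : LocStencil V Cs δ) (hδ : 0 ≤ δ)
    (hR : 1 ≤ R) :
    LocStencil (fun κ z => pushSum Lc R (V κ z)) (Cs * ((R : ℝ) ^ (d + 2)) ^ 2 * Real.exp (4 * (d + 1) * Lc * R * δ)) δ :=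
  fun κ z => biLoc_pushSum hR (hV κ z) hδ

omit [NeZero Lc] [NeZero R] in
/-- [folklore] `pushSum` keeps a vanishing multiplier–multiplier block. -/
theorem pushSum_inr_inr_eq_zero_of {K : MKer (d + 1) (Fib d)} (h : ∀ x z (μ ν : Fin (d + 1)), K x z (Sum.inr μ) (Sum.inr ν) = 0)
    (x z : Fin (d + 1) → ℤ) (μ ν : Fin (d + 1)) : pushSum Lc R K x z (Sum.inr μ) (Sum.inr ν) = 0 := by
  simp only [pushSum, h, Finset.sum_const_zero, mul_zero]

/-- NOT IN PRINT; OUR BOOKKEEPING ([folklore]).  **ROAD S3's ROOTED PUSHED BORDER ROW AS THE TENT PAIR**: for `N = Lc^(i+1)·R` (in-block root `ρ = toSite rr`),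
`e3OfS N (pushSum (Lc^(i+1)) R ∘ borderSum (Lc^i) (vhSAt ρ)) = ((Lc^i)^{d+2})⁻¹ • (push₃ B (tentLeg Lc R N) B (reslot inl inr (vhSAt ρ)) − push₃ (tentLeg Lc R N) B B (reslot inr inl (vhSAt ρ)))`,
`B = respStep (Lc^i) N` (`pushSum_borderSum`, PART 1's `mixed_push₃_eq_e3OfS_borderSum` on the pushed table, PART 2a's `push₃_colM_pushSum` ∕ `push₃_rowMM_pushSum`). -/
theorem road_v_eq_tent_pair (hLc : 1 ≤ Lc) {rr : Fin (d + 1) → ℕ} (hrr : rr ∈ box (d + 1) Lc) (i : ℕ) (hN : N = Lc ^ (i + 1) * R)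
    (κ' : Fin (d + 1)) (u' : Fin (d + 1) → ℤ) :
    e3OfS N (fun κ u => pushSum (Lc ^ (i + 1)) R (borderSum (Lc ^ i) (fun κ z => vhSAt (toSite rr) d Lc rfl κ z) κ u)) κ' u'
      = (((Lc : ℝ) ^ i) ^ (d + 2))⁻¹ •
          (push₃ (respStep (d := d) (Lc ^ i) N) (tentLeg Lc R N) (respStep (d := d) (Lc ^ i) N)
              (reslot Sum.inl Sum.inr fun κ u => vhSAt (toSite rr) d Lc rfl κ u) κ' u'
            - push₃ (tentLeg Lc R N) (respStep (d := d) (Lc ^ i) N) (respStep (d := d) (Lc ^ i) N)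
              (reslot Sum.inr Sum.inl fun κ u => vhSAt (toSite rr) d Lc rfl κ u) κ' u') := by
  haveI : NeZero (Lc ^ i * (Lc * R)) := ⟨mul_ne_zero (pow_ne_zero _ (NeZero.ne Lc)) (mul_ne_zero (NeZero.ne Lc) (NeZero.ne R))⟩
  have hR : 1 ≤ R := Nat.one_le_iff_ne_zero.2 (NeZero.ne R)
  have hN' : N = Lc ^ i * (Lc * R) := by rw [hN, pow_succ, mul_assoc]
  have hM : (((Lc : ℝ) ^ i) ^ (d + 2)) ≠ 0 := pow_ne_zero _ (pow_ne_zero _ (by exact_mod_cast NeZero.ne Lc))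
  have hV := locStencil_vhSAt (d := d) hLc hrr zero_le_one
  have hP := locStencil_pushSum (Lc := Lc) hV zero_le_one hR
  -- the e3OfS form of the pushed border row
  have e1 : e3OfS N (fun κ u => pushSum (Lc ^ (i + 1)) R (borderSum (Lc ^ i) (fun κ z => vhSAt (toSite rr) d Lc rfl κ z) κ u)) κ' u'
      = (((Lc : ℝ) ^ i) ^ (d + 2))⁻¹ • e3OfS N (fun κ u => ((((Lc ^ i : ℕ) : ℝ) ^ (d + 2))) •
          borderSum (Lc ^ i) (fun κ z => pushSum Lc R (vhSAt (toSite rr) d Lc rfl κ z)) κ u) κ' u' := by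
    rw [e3OfS_smul, smul_smul, Nat.cast_pow, inv_mul_cancel₀ hM, one_smul]
    congr 1
    funext κ u
    exact pushSum_borderSum _ i κ u
  rw [e1, ← mixed_push₃_eq_e3OfS_borderSum hN' hP one_pos
      (fun κ u x z α β => by simp only [pushSum_inl_inl, vhSAt_inl_inl])
      (fun κ u x z μ ν => pushSum_inr_inr_eq_zero_of (fun x z μ ν => vhSAt_inr_inr _ _ _ _ _ _ _ _) x z μ ν) κ' u']
  obtain ⟨C', m', hm', hB⟩ := exists_legDecay_respStep (d := d) hN'
  have hBb : ∀ α x' κ x, |respStep (d := d) (Lc ^ i) N α x' κ x| ≤ C' := fun α x' κ x => hB.abs_le hm'.le α x' κ x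
  rw [push₃_colM_pushSum hBb hB hm' hV one_pos hN' rfl κ' u', push₃_rowMM_pushSum hB hm' hV one_pos hN' rfl κ' u']

end Road

/-! ## §4 The identification -/

section Ident

variable {Lc : ℕ} [NeZero Lc] {R N : ℕ} [NeZero R] [NeZero N]

/-- NOT IN PRINT; OUR BOOKKEEPING ((V-U) multi-level; [folklore]).  **THE UNDRESSED V LINEAGE OF THE COMB FAMILY IS `e3OfS` OF ROAD S3's SYMMETRIC-TABLE ROOTED PUSHED
BORDER ROW**: for `N = Lc^(i+1)·R`, in-block root `ρ = toSite rr`,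
`push₃ B′ B′ B′ Y⁰_i κ′ u′ = e3OfS N (fun κ u ↦ (cVH·(smStep d Lc i)²·(Lc^i)^{d+2}) • pushSum (Lc^(i+1)) R (borderSum (Lc^i) (vhSAt ρ) κ u)) κ′ u′`
— the object of p2's `TaylorRowVSymAt.rowV_three_at` (`R = Lc^(n+1)`, `N = Lc^(i+n+1+1)`) up to the displayed k∕i-bookkept scalar. -/
theorem lineage_v_eq_e3OfS_pushSum (hLc : 1 ≤ Lc) {rr : Fin (d + 1) → ℕ} (hrr : rr ∈ box (d + 1) Lc) (cVH : ℝ) (i : ℕ)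
    (hN : N = Lc ^ (i + 1) * R) (κ' : Fin (d + 1)) (u' : Fin (d + 1) → ℤ) :
    push₃ (respStep (d := d) (Lc ^ (i + 1)) N) (respStep (d := d) (Lc ^ (i + 1)) N) (respStep (d := d) (Lc ^ (i + 1)) N)
        (fun κ u => -(push₃ (-respStep (d := d) (Lc ^ i) (Lc ^ (i + 1))) (colM (KStepUnit (d := d) Lc i) Lc)
              (respStep (d := d) (Lc ^ i) (Lc ^ (i + 1))) (reslot Sum.inl Sum.inr fun κ u => cVH • vhSAt (toSite rr) d Lc rfl κ u) κ u
          + push₃ (rowMM (KStepUnit (d := d) Lc i) Lc) (respStep (d := d) (Lc ^ i) (Lc ^ (i + 1)))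
              (respStep (d := d) (Lc ^ i) (Lc ^ (i + 1))) (reslot Sum.inr Sum.inl fun κ u => cVH • vhSAt (toSite rr) d Lc rfl κ u) κ u)) κ' u'
      = e3OfS N (fun κ u => (cVH * (smStep d Lc i) ^ 2 * (((Lc : ℝ) ^ i) ^ (d + 2))) •
          pushSum (Lc ^ (i + 1)) R (borderSum (Lc ^ i) (fun κ z => vhSAt (toSite rr) d Lc rfl κ z) κ u)) κ' u' := by
  have hM : (((Lc : ℝ) ^ i) ^ (d + 2)) ≠ 0 := pow_ne_zero _ (pow_ne_zero _ (by exact_mod_cast NeZero.ne Lc))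
  rw [lineage_v_eq_tent_pair hLc hrr cVH i hN κ' u', e3OfS_smul, road_v_eq_tent_pair hLc hrr i hN κ' u', smul_smul,
    mul_assoc, mul_inv_cancel₀ hM, mul_one]

/-- NOT IN PRINT; OUR BOOKKEEPING.  The same in lineage indexing `k = i+n+1+1`, `R = Lc^(n+1)`: the undressed V lineage from birth `i` read at level `k`. -/
theorem lineage_v_succ_eq_e3OfS_pushSum (hLc : 1 ≤ Lc) {rr : Fin (d + 1) → ℕ} (hrr : rr ∈ box (d + 1) Lc) (cVH : ℝ) (i n : ℕ)
    (κ' : Fin (d + 1)) (u' : Fin (d + 1) → ℤ) :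
    push₃ (respStep (d := d) (Lc ^ (i + 1)) (Lc ^ (i + n + 1 + 1))) (respStep (d := d) (Lc ^ (i + 1)) (Lc ^ (i + n + 1 + 1)))
        (respStep (d := d) (Lc ^ (i + 1)) (Lc ^ (i + n + 1 + 1)))
        (fun κ u => -(push₃ (-respStep (d := d) (Lc ^ i) (Lc ^ (i + 1))) (colM (KStepUnit (d := d) Lc i) Lc)
              (respStep (d := d) (Lc ^ i) (Lc ^ (i + 1))) (reslot Sum.inl Sum.inr fun κ u => cVH • vhSAt (toSite rr) d Lc rfl κ u) κ u
          + push₃ (rowMM (KStepUnit (d := d) Lc i) Lc) (respStep (d := d) (Lc ^ i) (Lc ^ (i + 1)))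
              (respStep (d := d) (Lc ^ i) (Lc ^ (i + 1))) (reslot Sum.inr Sum.inl fun κ u => cVH • vhSAt (toSite rr) d Lc rfl κ u) κ u)) κ' u'
      = e3OfS (Lc ^ (i + n + 1 + 1)) (fun κ u => (cVH * (smStep d Lc i) ^ 2 * (((Lc : ℝ) ^ i) ^ (d + 2))) •
          pushSum (Lc ^ (i + 1)) (Lc ^ (n + 1)) (borderSum (Lc ^ i) (fun κ z => vhSAt (toSite rr) d Lc rfl κ z) κ u)) κ' u' :=
  lineage_v_eq_e3OfS_pushSum hLc hrr cVH i (by rw [← pow_add]; ring_nf) κ' u'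

end Ident

end Summit.QuantumFields.BalabanUV.Beta.GAN24.BornBorderLiftChain

end
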